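import Mathlib

/-!
# Tier 3, T3.2 — TIGHTNESS of the interpolation glue's value ring: a Hausdorff linearly topologised FIELD is discrete,
so the Weierstrass glue cannot be instantiated on `ℂ_p` itself — the right `B` is the valuation ring `𝓞_ℂ_[p]`
(seat t3-p3, gen 11)

Blind re-derivation cell `pub-hodge-repro`, Tier-3 seat `t3-p3` (route/TIER3.md §3 row R-B).  The Weierstrass glue of
the chain (`Tier3Weierstrass.finite_vanishing_of_interpolation`, t3-p4; `Tier3PinningGlue.four_line_pinning_of_interpolation`,
t3-p3) assumes `[T2Space B] [IsTopologicalRing B] [IsLinearTopology B B]` on the ring `B` in which the evaluation points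
`ζ_ν − 1` live.  The lane's frozen paper (proofs/t3-p3/R2-PINNING.md §8.5) writes «B := ℂ_p»; its kernel instantiation
(ADDENDUM-1, `Tier3PadicComplexInt.four_line_pinning_padicComplexInt`) is at `B := 𝓞_ℂ_[p]`.  This file records why the
second is the only reading:

* `discreteTopology_of_isLinearTopology` — a Hausdorff field with a linear topology (the ideals that are neighbourhoods
  of `0` form a basis of `𝓝 0`) is DISCRETE: `{1}ᶜ` is a neighbourhood of `0`, the ideal it contains is not `⊤`, so it
  is `⊥ = {0}`, which is therefore open;
* `eq_zero_of_isTopologicallyNilpotent` — in a discrete domain a topologically nilpotent element is `0`;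
* `subsingleton_of_injective_hasEval_sub_one` / `not_infinite_of_injective_hasEval_sub_one` — on a Hausdorff linearly
  topologised field an injective family `ζ : Ξ → K` with every `ζ ν − 1` an evaluation point (`PowerSeries.HasEval`)
  forces `Ξ` to be a subsingleton: the glue's hypotheses `hζ`, `hev` and `[Infinite Ξ]` are jointly unsatisfiable when
  `B` is a field;
* `not_discreteTopology_of_nontriviallyNormedField` / `not_isLinearTopology_padicComplex` — `ℂ_[p]` (a nontrivially
  normed field) is not discrete, hence carries NO `IsLinearTopology ℂ_[p] ℂ_[p]` instance; `𝓞_ℂ_[p]` does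
  (`Tier3PadicComplexInt`, landed).

HONESTY.  Nothing here is about Hecke characters or `L`-values; it is a statement about Mathlib's `IsLinearTopology`
that fixes one wording of the lane's frozen paper («B := ℂ_p» reads «B := 𝓞_{ℂ_p}»).  Nothing here says anything about
the status of the Hodge conjecture for CM abelian varieties, which is NOT proved.
-/

set_option autoImplicit false

namespace Summit.Ventures.HodgeRepro.T3.LinearTopologyTightness

open Filter Topology

section Field

variable {K : Type*} [Field K] [TopologicalSpace K] [IsTopologicalAddGroup K] [T2Space K]

/-- A Hausdorff field whose topology is linear (`IsLinearTopology K K`: the ideals that are neighbourhoods of `0` form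
a basis of `𝓝 0`) is discrete: `{1}ᶜ` is a neighbourhood of `0`, the ideal of the basis inside it is not `⊤`, hence is
`⊥ = {0}`, an additive subgroup that is a neighbourhood of `0`, hence open. -/
theorem discreteTopology_of_isLinearTopology [IsLinearTopology K K] : DiscreteTopology K := by
  have h1 : ({1}ᶜ : Set K) ∈ 𝓝 (0 : K) :=
    isOpen_compl_singleton.mem_nhds (by simp)
  obtain ⟨N, hN, hNs⟩ := (IsLinearTopology.hasBasis_submodule K (M := K)).mem_iff.mp h1
  have hbot : N = ⊥ := by
    rcases Ideal.eq_bot_or_top N with h | h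
    · exact h
    · exfalso
      have h1N : (1 : K) ∈ (N : Set K) := by simp [h]
      exact hNs h1N rfl
  subst hbot
  have hopen : IsOpen ((⊥ : Submodule K K) : Set K) :=
    (⊥ : Submodule K K).toAddSubgroup.isOpen_of_mem_nhds hN
  rw [Submodule.bot_coe] at hopen
  exact discreteTopology_of_isOpen_singleton_zero hopen

end Field

section Domain

variable {B : Type*} [CommRing B] [IsDomain B] [TopologicalSpace B] [DiscreteTopology B]

/-- In a discrete domain a topologically nilpotent element is `0`: its powers are eventually in the open set `{0}`,
and a domain has no nilpotents. -/
theorem eq_zero_of_isTopologicallyNilpotent {a : B} (ha : IsTopologicallyNilpotent a) : a = 0 := by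
  have h0 : ({0} : Set B) ∈ 𝓝 (0 : B) := (isOpen_discrete _).mem_nhds rfl
  obtain ⟨n, hn⟩ := (ha.eventually_mem h0).exists_forall_of_atTop
  have hpow : a ^ (n + 1) = 0 := Set.mem_singleton_iff.mp (hn (n + 1) (Nat.le_succ n))
  exact (pow_eq_zero_iff (Nat.succ_ne_zero n)).mp hpow

end Domain

section Tightness

variable {K : Type*} [Field K] [TopologicalSpace K] [IsTopologicalAddGroup K] [T2Space K] [IsLinearTopology K K]

/-- **Tightness of the glue's value ring.** On a Hausdorff linearly topologised field `K` (which is discrete by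
`discreteTopology_of_isLinearTopology`), every evaluation point `ζ ν − 1` is `0`, so an injective `ζ : Ξ → K` with
`PowerSeries.HasEval (ζ ν − 1)` for all `ν` forces `Ξ` to be a subsingleton. -/
theorem subsingleton_of_injective_hasEval_sub_one {Ξ : Type*} (ζ : Ξ → K) (hζ : Function.Injective ζ)
    (hev : ∀ ν, PowerSeries.HasEval (ζ ν - 1)) : Subsingleton Ξ := by
  haveI : DiscreteTopology K := discreteTopology_of_isLinearTopology
  have hone : ∀ ν, ζ ν = 1 := fun ν => sub_eq_zero.mp (eq_zero_of_isTopologicallyNilpotent (hev ν))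
  exact ⟨fun ν ν' => hζ (by rw [hone ν, hone ν'])⟩

/-- The hypotheses `[Infinite Ξ]`, `hζ : Function.Injective ζ`, `hev : ∀ ν, HasEval (ζ ν - 1)` of the interpolation
glue (`Tier3PinningGlue.infinite_common_good_of_interpolation` / `four_line_pinning_of_interpolation`) are jointly
unsatisfiable when the value ring is a Hausdorff linearly topologised FIELD. -/
theorem not_infinite_of_injective_hasEval_sub_one {Ξ : Type*} (ζ : Ξ → K) (hζ : Function.Injective ζ)
    (hev : ∀ ν, PowerSeries.HasEval (ζ ν - 1)) : ¬ Infinite Ξ := by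
  intro hinf
  haveI := hinf
  haveI := subsingleton_of_injective_hasEval_sub_one ζ hζ hev
  exact not_finite Ξ

end Tightness

section PadicComplex

/-- A nontrivially normed field is not discrete: some `x` has `1 < ‖x‖`, while in a discrete normed division ring every
non-zero element has norm `1` (`NormedDivisionRing.norm_eq_one_iff_ne_zero_of_discrete`). -/
theorem not_discreteTopology_of_nontriviallyNormedField (𝕜 : Type*) [NontriviallyNormedField 𝕜] :
    ¬ DiscreteTopology 𝕜 := by
  intro hd
  obtain ⟨x, hx⟩ := NontriviallyNormedField.non_trivial (α := 𝕜)
  have hx0 : x ≠ 0 := by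
    rintro rfl
    norm_num at hx
  have h1 := NormedDivisionRing.norm_eq_one_iff_ne_zero_of_discrete.mpr hx0
  rw [h1] at hx
  exact lt_irrefl _ hx

/-- `ℂ_[p]` carries no linear topology over itself: it is a nontrivially normed field, hence not discrete, while a
Hausdorff linearly topologised field is discrete.  The glue's `B` must be `𝓞_ℂ_[p]` (Tier3PadicComplexInt), not `ℂ_[p]`. -/
theorem not_isLinearTopology_padicComplex (p : ℕ) [Fact p.Prime] : ¬ IsLinearTopology ℂ_[p] ℂ_[p] :=
  fun _ => not_discreteTopology_of_nontriviallyNormedField ℂ_[p] discreteTopology_of_isLinearTopology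

end PadicComplex

end Summit.Ventures.HodgeRepro.T3.LinearTopologyTightness
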